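import Summits.HodgeConjecture.HodgeConjecture.Theorems.PadicSemiregularLiftHodgeFermatVarietiesStubClaimLevelPullFacts
import Summits.HodgeConjecture.HodgeConjecture.Theorems.PadicSemiregularLiftHodgeFermatVarietiesStubClaimLevelPushHolds
import Literature.AlgebraicGeometry.HodgeTheory.FermatLevelMapPullback
import Literature.AlgebraicGeometry.HodgeTheory.FermatEigenspaceMultiplicityOne
import HarnessLib

/-!
# `stub_claimLevelPull` modulo ONE input: Bredon II.19.2, or the existence of Fermat eigenclasses (Fulton Cor. 19.2 (b) eliminated) — line `witt-lift-rigid-mf`, crux `FermatAnchorAssembly` (stmt-HodgeConjecture-14874)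

Helper file (`--supports stmt-HodgeConjecture-14874`) for the stub `stub_claimLevelPull` (L5d, =
crux 1334's S2↑) of the skeleton of line `witt-lift-rigid-mf`: claim_m(α') ⟹ claim_{km}(k • α')
along the level map `π : X²ʳ_{km} → X²ʳₘ`, `[xᵢ] ↦ [xᵢᵏ]` (Shioda–Katsura 1979 §1; Aoki 1987
p. 387 and Cor. 2-3). The tree had reduced the stub to TWO general named facts
(`CancelByAnyClaimLattice.stub_claimLevelPull_of_facts hF hB`): (F)
`fulton1998_map_mem_algebraicClasses` (Fulton Cor. 19.2 (b): pull-back of algebraic classes along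
any morphism of smooth projective varieties) and (B) `bredon1997_quotient_cohomology_invariants`
(Bredon II.19.2: the complex cohomology of a finite quotient is the invariant cohomology). (F) was
used only at `π`, and at `π` it is now a THEOREM: `π` is a finite morphism
(`isFinite_fermatLevelMap_left`, `HodgeTheory/FermatLevelMapFinite`) between smooth projective
varieties of the same dimension, and quasi-finite equidimensional pull-backs preserve the coniveau
filtration (`map_mem_algebraicClasses_of_locallyQuasiFinite`,
`HodgeTheory/SupportedClassesQuasiFinitePullback`; at `π`: `map_mem_algebraicClasses_of_fermatLevelMap`,
`HodgeTheory/FermatLevelMapPullback`). PROVED here: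

* `map_fermatLevelMap_injective` — **`π^*` is injective on `H*(Xⁿₘ(ℂ); ℂ)`** (`n, k, m ≥ 1`): the
  push-pull scalar `π_* π^* = c •` exists (`exists_complexGysin_map_eq_smul`) and is non-zero
  since `π^* ≠ 0` on `H²ⁿ` (`exists_map_fermatLevelMap_top_ne_zero`, `pushPull_scalar_ne_zero`);
* `claimLevelPull_of_transfer` — **S2↑ from the transfer (M4) for `fermatLevelMap` alone**
  (`stub_claimLevelPull_of_transfer` with its hypothesis (F) discharged): the same proof, its last
  line now `map_mem_algebraicClasses_of_fermatLevelMap`;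
* `stub_claimLevelPull_of_bredon` — **the registered statement of `stub_claimLevelPull` from the ONE
  named fact `bredon1997_quotient_cohomology_invariants`** ((M4) = `transfer_fermatLevelMap hB`);
* `claimLevelPull_of_exists_eigenclass` — **the registered statement from the existence of
  eigenclasses instead** (the equality half `dim V(α) = 1`, `α` zero-free with `Σ αᵢ = 0`, of Ran
  1980 Prop. 1.7 (i), kept as the explicit hypothesis `hE`; the tree proves `≤ 1` only,
  `Ran1980_fermatEigenspace_le_span_holds`): for `0 ≠ c ∈ V_{km}(k • α')`, `Σ (k • α')ᵢ = 0`
  (`fermatEigenspace_eq_bot_of_sum_ne_zero`), so `Σ α'ᵢ = 0`, so by `hE` there is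
  `0 ≠ w ∈ V_m(α') ⊆ Alg(X_m)`; `0 ≠ π^* w ∈ V_{km}(k • α')` (`map_fermatLevelMap_injective`,
  `map_mem_fermatEigenspace_of_levelMap`), a line (`fermatEigenspace_le_span_of_ne_zero`), so
  `c ∈ ℂ · π^* w ⊆ π^*(Alg) ⊆ Alg` (`map_mem_algebraicClasses_of_fermatLevelMap`). This is the
  "eigenspace count" route to (M4) made exact: what it needs beyond the tree is precisely `hE`.

REMAINING for the unconditional stub (2026-08-17): (B), or `hE`. They are the two printed sources
of the one missing statement "`V_{km}(k • α') ≠ 0 ⟹ V_m(α') ≠ 0`": the transfer for the NON-free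
quotient `X_{km} → X_{km}/(μₖ)²ʳ⁺² = X_m` (the tree has the free case only, `FiniteDeckCover.*`),
or Pham–Brieskorn EXISTENCE of every all-non-trivial torus character in `H₂ᵣ` of the join plus
exactness of the Thom–Gysin sequence at `H²ʳ(U_k)` (the tree has multiplicity `≤ 1` and exactness
at `H²ʳ(X)` only).

## References

* [ShiodaKatsura1979] T. Shioda, T. Katsura, On Fermat varieties, Tôhoku Math. J. 31 (1979), §1.
* [Aoki1987] N. Aoki, Some new algebraic cycles on Fermat varieties, J. Math. Soc. Japan 39 (1987),
  §1 p. 387 and Cor. 2-3; p. 385 (`dim V(α) = 1`).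
* [Ran1980] Z. Ran, Cycles on Fermat hypersurfaces, Compositio Math. 42 (1980), §1 Prop. 1.7 (i).
* [Bredon1997] G. E. Bredon, Sheaf Theory, 2nd ed., GTM 170 (1997), II Thm. 19.2, III Thm. 1.1.
* [Fulton1998] W. Fulton, Intersection Theory, 2nd ed. (1998), §19.2 Cor. 19.2 (b) (now proved at `π`).
* [FultonYoungTableaux1997] W. Fulton, Young Tableaux (1997), App. B §B.1 (6)–(7) (`π_* π^* = deg π`).
-/

set_option linter.dupNamespace false

noncomputable section

open CategoryTheory AlgebraicGeometry Finset
open Literature.AlgebraicGeometry Literature.AlgebraicGeometry.Motives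
open Literature.AlgebraicGeometry.HodgeTheory Literature.AlgebraicGeometry.HodgeTheory.FermatCharacter
open Literature.AlgebraicTopology.SingularHomology
open Summit.HodgeConjecture.HodgeConjecture.Theorems.CancelByAnyClaimLattice

namespace Summit.HodgeConjecture.HodgeConjecture.Cruxes.FermatAnchorAssembly.WittLiftRigidMf

/-! ### `π^*` is injective -/

section Injective

variable {n m k : ℕ}

/-- **`π^*` is injective on `Hᵃ(Xⁿₘ(ℂ); ℂ)` in every degree** for the level map
`π = fermatLevelMap n hk hm`, `n, k, m ≥ 1`: there is a push-pull scalar `c` with `π_* (π^* x) = c • x`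
in all degrees (`exists_complexGysin_map_eq_smul`, for the complex orientations), and `c ≠ 0`
because `π^*` is non-zero on the top cohomology `H²ⁿ(Xⁿₘ(ℂ); ℂ)`
(`exists_map_fermatLevelMap_top_ne_zero`, `pushPull_scalar_ne_zero`); so `π^* x = 0` forces
`c • x = π_* 0 = 0`, `x = 0`. In print: `π_* π^* = deg π = k^{n+1}`.
[cite: FultonYoungTableaux1997, Appendix B §B.1 (6)–(7)] [cite: ShiodaKatsura1979, §1] -/
theorem map_fermatLevelMap_injective (hn : 1 ≤ n) (hk : 0 < k) (hm : 0 < m) (a : ℕ) :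
    Function.Injective (complexBetti.map (fermatLevelMap n hk hm) a).hom := by
  have hY : IsSmoothProjective n (fermatHypersurface n (k * m)) :=
    isSmoothProjective_fermatHypersurface hn (Nat.mul_pos hk hm)
  have hX : IsSmoothProjective n (fermatHypersurface n m) := isSmoothProjective_fermatHypersurface hn hm
  obtain ⟨c, hc⟩ := exists_complexGysin_map_eq_smul complexOrientationFamily hY hX (fermatLevelMap n hk hm)
  obtain ⟨ω, hω⟩ := exists_map_fermatLevelMap_top_ne_zero hn hk hm
  have hc0 : c ≠ 0 := pushPull_scalar_ne_zero complexOrientationFamily hY hX _ (hc (2 * n)) hω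
  rw [injective_iff_map_eq_zero]
  intro x hx
  have h := hc a x
  have hx' : complexBetti.map (fermatLevelMap n hk hm) a x = 0 := hx
  rw [hx', LinearMap.map_zero] at h
  exact (smul_eq_zero.1 h.symm).resolve_left hc0

end Injective

/-! ### S2↑ from the transfer for the level map alone -/

section LevelPull

/-- **S2↑ `stub_claimLevelPull` modulo the finite-quotient transfer only** (Fulton Cor. 19.2 (b)
eliminated). GRANTED (M4) the transfer for the level map `π = fermatLevelMap (2r) hk hm :
X²ʳ_{km} ⟶ X²ʳₘ`, `[xᵢ] ↦ [xᵢᵏ]` (every class of `H²ʳ(X²ʳ_{km}(ℂ); ℂ)` fixed by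
`K = {a ∈ μ_{km}^{2r+2} | aᵏ = 1}` is in the range of `π^*`), claim pulls back along the level map:
claim_m(α') ⟹ claim_{km}(k • α') for every `k ≥ 1` and zero-free `α'`. Proof = that of
`stub_claimLevelPull_of_transfer`: for `c ∈ V_{km}(k • α')` and `a ∈ K`, `g_a^* c = χ_{k•α'}(a) c = c`
(`fermatCharacter_levelRaise_eq_one`), so `c = π^* c₀` by (M4); `c₀ = Σ_γ proj_γ c₀`
(`sum_fermatProjector`) with `π^* proj_γ c₀ ∈ V_{km}(k • γ)` (`map_mem_fermatEigenspace_of_levelMap`)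
and `γ ↦ k • γ` injective (`levelRaise_injective`), so `c = π^*(proj_{α'} c₀)`;
`proj_{α'} c₀ ∈ V_m(α') ⊆ Nʳ H²ʳ(X_m)` by claim_m(α'); and `π^*` preserves `Nʳ H²ʳ` because `π` is a
FINITE morphism between smooth projective varieties of the same dimension
(`map_mem_algebraicClasses_of_fermatLevelMap`: codimension of supports does not drop on preimages
along quasi-finite maps). Degenerate cases `r = 0` (`FermatCharacter.claim_zero`), `m = 0`
(`claim_level_zero`). [cite: ShiodaKatsura1979, §1] [cite: Aoki1987, §1 p. 387 and Cor. 2-3 (p. 388)]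
[cite: Fulton1998, §19.2 Cor. 19.2 (b)] -/
theorem claimLevelPull_of_transfer
    (hT : ∀ (m k r : ℕ) (hm : 0 < m) (hk : 0 < k)
      (c : complexBetti (fermatHypersurface (2 * r) (k * m)) (2 * r)),
      (∀ (a : Fin (2 * r + 2) → ℂˣ) (ha : a ∈ fermatGroup (2 * r) (k * m)), a ^ k = 1 →
        singularCohomology.map ℂ ℂ (diagonalMap (fermatPolynomial ℂ (2 * r) (k * m))
          (fermatGroup_le_diagonalStabilizer (k * m) ha)) (2 * r) c = c) →
      c ∈ LinearMap.range (complexBetti.map (fermatLevelMap (2 * r) hk hm) (2 * r)).hom)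
    (m k r : ℕ) (α' : Fin (2 * r + 2) → ZMod m) (hk : 0 < k) (_hα' : ∀ i, α' i ≠ 0)
    (hC : FermatCharacter.Claim m r α') :
    FermatCharacter.Claim (k * m) r (fun i => ((k * (α' i).val : ℕ) : ZMod (k * m))) := by
  rcases Nat.eq_zero_or_pos r with rfl | hr
  · exact FermatCharacter.claim_zero (k * m) _
  rcases Nat.eq_zero_or_pos m with rfl | hm
  · exact claim_level_zero r _
  haveI : NeZero m := ⟨hm.ne'⟩
  have hkm : 0 < k * m := Nat.mul_pos hk hm
  haveI : NeZero (k * m) := ⟨hkm.ne'⟩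
  set π := fermatLevelMap (2 * r) hk hm
  have h2 := exists_rep_hypersurfacePoint_map_fermatLevelMap (n := 2 * r) hk hm
  intro c hc
  -- Step 1: `c` is `K`-invariant, hence `c = π^* c₀`
  obtain ⟨c₀, hc₀⟩ : c ∈ LinearMap.range (complexBetti.map π (2 * r)).hom := by
    refine hT m k r hm hk c fun a ha hak ↦ ?_
    rw [(mem_fermatEigenspace_iff.mp hc) ⟨a, ha⟩, fermatCharacter_levelRaise_eq_one hk α' ha hak,
      Units.val_one, one_smul]
  -- Step 2/3: `c = π^* (proj_{α'} c₀)`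
  have hsum : c = ∑ γ : Fin (2 * r + 2) → ZMod m,
      complexBetti.map π (2 * r) (fermatProjector m γ (2 * r) c₀) := by
    rw [← map_sum, sum_fermatProjector]
    exact hc₀.symm
  have key : c = complexBetti.map π (2 * r) (fermatProjector m α' (2 * r) c₀) := by
    rw [← fermatProjector_apply_of_mem hc]
    conv_lhs => rw [hsum, map_sum]
    rw [Finset.sum_eq_single α']
    · exact fermatProjector_apply_of_mem
        (map_mem_fermatEigenspace_of_levelMap hk π h2 (fermatProjector_mem α' c₀))
    · intro γ _ hγ
      exact fermatProjector_apply_of_mem_of_ne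
        (map_mem_fermatEigenspace_of_levelMap hk π h2 (fermatProjector_mem γ c₀))
        fun h ↦ hγ (levelRaise_injective hk h)
    · exact fun h ↦ absurd (Finset.mem_univ α') h
  -- Step 4: pull-back along the FINITE level map preserves algebraic classes (a theorem)
  rw [key]
  exact map_mem_algebraicClasses_of_fermatLevelMap (by omega) hk hm (hC (fermatProjector_mem α' c₀))

/-- **S2↑ `stub_claimLevelPull` modulo Bredon II.19.2 alone (registered conditional form, Fulton
eliminated).** GRANTED the named fact `bredon1997_quotient_cohomology_invariants` (the complex
cohomology of a finite quotient of a compact Hausdorff locally contractible space is the invariant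
cohomology), claim pulls back along the level map `[xᵢ] ↦ [xᵢᵏ]`: claim_m(α') ⟹ claim_{km}(k • α')
for every `k ≥ 1`, `r`, zero-free `α'` — the registered statement of `stub_claimLevelPull`
(`claimLevelPull_of_transfer` with (M4) = `transfer_fermatLevelMap hB` at `n = 2r`). Improves
`CancelByAnyClaimLattice.stub_claimLevelPull_of_facts` (two named facts) to one.
[cite: ShiodaKatsura1979, §1] [cite: Aoki1987, §1 p. 387 and Cor. 2-3]
[cite: Bredon1997, II Thm. 19.2 and III Thm. 1.1] -/
theorem stub_claimLevelPull_of_bredon : bredon1997_quotient_cohomology_invariants → ∀ (m k r : ℕ) (α' : Fin (2 * r + 2) → ZMod m), 0 < k → (∀ i, α' i ≠ 0) → FermatCharacter.Claim m r α' → FermatCharacter.Claim (k * m) r (fun i => ((k * (α' i).val : ℕ) : ZMod (k * m))) :=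
  fun hB ↦ claimLevelPull_of_transfer fun _ _ r hm hk c hc ↦ transfer_fermatLevelMap hB hm hk (2 * r) c hc

end LevelPull

/-! ### S2↑ from the existence of eigenclasses (the eigenspace count made exact) -/

section Eigenclass

/-- **S2↑ `stub_claimLevelPull` modulo the existence of Fermat eigenclasses** (registered
statement as conclusion; Fulton AND Bredon eliminated, replaced by the explicit hypothesis `hE`).
GRANTED `hE`: for `r ≥ 1`, `m ≥ 1` and a zero-free character `α` of `X²ʳₘ` with `Σ αᵢ = 0`, the
eigenspace `V_m(α) ⊆ H²ʳ(X²ʳₘ(ℂ); ℂ)` is non-zero (the equality half "`dim V(α) = 1`" of Ran 1980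
Prop. 1.7 (i) / Aoki 1987 p. 385; the tree proves `≤ 1`), claim pulls back along the level map.
For `0 ≠ c ∈ V_{km}(β)`, `β = k • α'`: `Σ βᵢ = 0` (`fermatEigenspace_eq_bot_of_sum_ne_zero`), i.e.
`km ∣ k Σ⟨α'ᵢ⟩`, so `Σ α'ᵢ = 0`; `hE` gives `0 ≠ w ∈ V_m(α')`, algebraic by claim_m(α'); then
`π^* w ≠ 0` (`map_fermatLevelMap_injective`) lies in `V_{km}(β)` (`map_mem_fermatEigenspace_of_levelMap`),
which is at most a line (`fermatEigenspace_le_span_of_ne_zero`, `β ≠ 0`), so `c` is a multiple of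
`π^* w ∈ π^*(Nʳ H²ʳ(X_m)) ⊆ Nʳ H²ʳ(X_{km})` (`map_mem_algebraicClasses_of_fermatLevelMap`).
Degenerate cases `r = 0`, `m = 0` as before. [cite: Ran1980, §1 Prop. 1.7 (i)]
[cite: Aoki1987, p. 385 (dim V(α) = 1) and Cor. 2-3] [cite: ShiodaKatsura1979, §1] -/
theorem claimLevelPull_of_exists_eigenclass
    (hE : ∀ (m r : ℕ) [NeZero m] (α : Fin (2 * r + 2) → ZMod m), 1 ≤ r → (∀ i, α i ≠ 0) →
      ∑ i, α i = 0 → fermatEigenspace m α (2 * r) ≠ ⊥)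
    (m k r : ℕ) (α' : Fin (2 * r + 2) → ZMod m) (hk : 0 < k) (hα' : ∀ i, α' i ≠ 0)
    (hC : FermatCharacter.Claim m r α') :
    FermatCharacter.Claim (k * m) r (fun i => ((k * (α' i).val : ℕ) : ZMod (k * m))) := by
  rcases Nat.eq_zero_or_pos r with rfl | hr
  · exact FermatCharacter.claim_zero (k * m) _
  rcases Nat.eq_zero_or_pos m with rfl | hm
  · exact claim_level_zero r _
  haveI : NeZero m := ⟨hm.ne'⟩
  have hkm : 0 < k * m := Nat.mul_pos hk hm
  haveI : NeZero (k * m) := ⟨hkm.ne'⟩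
  set π := fermatLevelMap (2 * r) hk hm
  set β : Fin (2 * r + 2) → ZMod (k * m) := fun i => ((k * (α' i).val : ℕ) : ZMod (k * m)) with hβ
  have h2 := exists_rep_hypersurfacePoint_map_fermatLevelMap (n := 2 * r) hk hm
  intro c hc
  by_cases hc0 : c = 0
  · rw [hc0]; exact zero_mem _
  -- `β` is zero-free, in particular non-zero
  have hβ0 : β ≠ 0 := fun h ↦ by
    have h0 := congrArg ZMod.val (congrFun h 0)
    rw [hβ, val_levelRaise_coord hk, Pi.zero_apply, ZMod.val_zero, mul_eq_zero] at h0
    rcases h0 with h0 | h0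
    · exact hk.ne' h0
    · exact hα' 0 ((ZMod.val_eq_zero _).mp h0)
  -- `Σ βᵢ = 0` since `V_{km}(β) ∋ c ≠ 0`
  have hβsum : ∑ i, β i = 0 := by
    by_contra hne
    have h := fermatEigenspace_eq_bot_of_sum_ne_zero hne (2 * r)
    rw [h, Submodule.mem_bot] at hc
    exact hc0 hc
  -- hence `Σ α'ᵢ = 0`
  have hαsum : ∑ i, α' i = 0 := by
    have h1 : ((∑ i, k * (α' i).val : ℕ) : ZMod (k * m)) = 0 := by
      rw [Nat.cast_sum]; exact hβsum
    rw [ZMod.natCast_eq_zero_iff, ← Finset.mul_sum] at h1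
    have h3 : ((∑ i, (α' i).val : ℕ) : ZMod m) = 0 :=
      (ZMod.natCast_eq_zero_iff _ _).mpr (Nat.dvd_of_mul_dvd_mul_left hk h1)
    rw [Nat.cast_sum] at h3
    simpa only [ZMod.natCast_zmod_val] using h3
  -- a non-zero eigenclass downstairs, algebraic by claim_m(α')
  obtain ⟨w, hw, hw0⟩ := (Submodule.ne_bot_iff _).mp (hE m r α' hr hα' hαsum)
  have hπw : complexBetti.map π (2 * r) w ∈ fermatEigenspace (k * m) β (2 * r) :=
    map_mem_fermatEigenspace_of_levelMap hk π h2 hw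
  have hπw0 : complexBetti.map π (2 * r) w ≠ 0 := fun h0 ↦
    hw0 (map_fermatLevelMap_injective (by omega) hk hm (2 * r) (h0.trans (map_zero _).symm))
  -- `V_{km}(β)` is at most a line: `c` is a multiple of `π^* w`
  obtain ⟨v, hv⟩ := fermatEigenspace_le_span_of_ne_zero (m := k * m) hkm.ne' hr 0 hβ0
  obtain ⟨t, ht⟩ := Submodule.mem_span_singleton.mp (hv hc)
  obtain ⟨s, hs⟩ := Submodule.mem_span_singleton.mp (hv hπw)
  have hs0 : s ≠ 0 := by
    rintro rfl
    rw [zero_smul] at hs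
    exact hπw0 hs.symm
  have hcw : c = (t / s) • complexBetti.map π (2 * r) w := by
    rw [← hs, smul_smul, div_mul_cancel₀ t hs0, ht]
  rw [hcw]
  exact Submodule.smul_mem _ _ (map_mem_algebraicClasses_of_fermatLevelMap (by omega) hk hm (hC hw))

end Eigenclass

end Summit.HodgeConjecture.HodgeConjecture.Cruxes.FermatAnchorAssembly.WittLiftRigidMf

end
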